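import Summits.BirchSwinnertonDyer.Rank1Residual.X10.BeyondCarrierResidualOfTwins
import Summits.BirchSwinnertonDyer.BirchSwinnertonDyer.Theses.PrintX10b
import HarnessLib

/-!
# Crux `BeyondCarrierDepthX10b` (stmt-BirchSwinnertonDyer-23055, `route-BirchSwinnertonDyer-PrintX10b`
# rev 19, rank 301): the twins A₃ ∧ B₃ give the crux — and its parent J₃ — on ALL frames, modulo three
# named facts (line «twins», lead seat bsd-line-x10b-p1, skeleton v4)

HONEST FRAMING (cell `run/shared/lean/pub/bsd-print-x9/`, D-0131 print tier; LEAD of the registered line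
«twins» on crux 23055, D-0154 KEY row 10): THEOREMS ONLY, conditional glue, nothing booked. The crux
`BeyondCarrierDepthX10b` is NOT closed by this file: its two OPEN inputs are the route items BY NAME
`hA : HowardContainmentAnyClassNumberX10b` (stmt-BirchSwinnertonDyer-23729, A₃: Howard's containment
`I(ℋ_∞)² ⊆ char_Λ(X_tors)` at `p = 3` on class X10b, ANY class number — its `μ`-part on the `3 ∣ h_K`
frames is beyond print, cell DOSSIER §41.12–41.13) and `hB : TwoSidedLinkAnyClassNumberX10b`
(stmt-BirchSwinnertonDyer-23730, B₃: the two-sided IMC∘BDP–Waldspurger link granted the containment,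
ANY class number), plus THREE cite-only named facts: `h331` (Jetchev–Skinner–Wan 2017 Thm. 3.3.1 —
route aside `JSWAnticyclotomicControl`, stmt-20535), `hKo` (Kolyvagin 1990 Thm. A — conjunct 2 of the
route binder `HeegnerPrintFactsX10b`) and `hChaL` (Cha 2005 Thm. 21 / Rmk. 25, LOWER half — flagged
`Cha05-Rmk25-remark-only` by the cell referee; NOT a binder of `closes`). «beyond-print theorem»: NO.
BSD is not proved by any of this.

WHAT — the observation behind the lead's reshape of the registered skeleton (v3 8c72ce4e → v4). The
landed turnkey T-A `stub_beyondCarrier_divisibleClassNumber_of_twins_of_namedFacts` (ty3 g11, module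
`Rank1Residual.X10.BeyondCarrierResidualOfTwins`) proves the `3 ∣ h_K` residual stub of skeleton v2/v3
from A₃, B₃ and the three facts, and its proof never uses the frame binder `3 ∣ h_K`, never uses the
beyond-carrier clause `∀ q ∣ N, ord_3 c_q(E) < s`, and never uses `r_an(E/ℚ) = 1` (rank one over `K`
comes from `y_K` of infinite order by Kolyvagin). Hence the SAME argument — index identity over `K`
from the twins (`indexIdentityAt_of_heegnerPoint_of_twins_of_thm331`: `2·ord_3 ∏ c_q + ord_3 #Ш(E/K)
= 2·ord_3 [E(K):ℤy_K]`), then Cha's lower half against a non-divisible derived point — gives: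
* `heegnerDivisibilityX10b_of_twins_of_namedFacts` — the PARENT crux `HeegnerDivisibilityX10b`
  (stmt-BirchSwinnertonDyer-21340, J₃: ALL depths `s ≤ ord_3 ∏ c_q`, ALL class numbers) BY NAME from
  `h331`, `hChaL`, `hKo`, `hA`, `hB` — with NO Mastella–Zerman Cor. 4.6 (`h46`), NO Yan–Zhu/BCS/CGLS
  composite (`hYZ`, flag `YZ26@3-BF-ERL-Ohta`), and NO Jetchev chain / `JetchevPrintFactsX10b`
  (stmt-22890: Gross Prop. 3.7 (2), Poitou–Tate for Selmer structures, GZ identity component);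
* `stub_beyondCarrier_allFrames_of_twins_of_namedFacts` — the registered stub
  `stub_beyondCarrier_allFrames_of_twins : A₃ → B₃ → ‹body of BeyondCarrierDepthX10b›` of skeleton v4
  BY SIGNATURE, modulo the three facts (one weakening step from the previous theorem);
* `beyondCarrierDepthX10b_of_twins_of_threeFacts` — the crux BY NAME from the five hypotheses (the
  door `beyondCarrierDepthX10b_of_namedFacts_of_twins` of `Rank1Residual.X10.BeyondCarrierDoorOfTwins`
  minus its two idle premisses `h46`, `hYZ`).
So, in the kernel: 23055 ⟸ 23729 ∧ 23730 ∧ {JSW 3.3.1, Kolyvagin Thm. A, Cha Rmk. 25 lower}; and the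
same five inputs already give the parent 21340. What 23055 actually consumes of the twins is strictly
less than the items state: A₃ and B₃ are applied only at frames with `d_K ≡ 1 (mod 8)` (odd, `≠ -3, -4`),
`N_E` and `3` split, `E(K)` of rank one with `Ш(E/K)[3^∞]` finite (so `corank_{ℤ₃} Sel_{3^∞}(E/K) = 1`:
the `(γ - 1)`-localisation of CGLS 2022 Thm. 4.1.3 is not needed there, only its `p`-part).

References: [Cha2005] Thm. 21, Rmk. 25; [JetchevSkinnerWan2017] Thm. 3.3.1; [Kolyvagin1990] Thm. A;
[MatarNekovar2019] Prop. 5.26 (2) (tree theorem); [Darmon2004] Thm. 3.7 (tree theorem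
`heegnerPointOfConductor_one_galoisConj_holds`); [McCallumLMS1991] §5; [Howard2004HeegnerKolyvagin]
Thm. B; [CastellaGrossiLeeSkinner2022] Thm. 4.1.3; route file `Theses/PrintX10b.lean` rev 19 (items
21340 / 23055 / 23729 / 23730); registered skeletons v3 (plan g5, 8c72ce4e) and v4 (this lead).
-/

-- the REGISTERED stub namespace `Summit.BirchSwinnertonDyer.BirchSwinnertonDyer.Cruxes.…` repeats the summit name
set_option linter.dupNamespace false
set_option autoImplicit false

noncomputable section

open scoped Classical MatrixGroups ModularForm

open CongruenceSubgroup WeierstrassCurve NumberField IsDedekindDomain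
  Literature.NumberTheory.EllipticCurves Literature.NumberTheory.EllipticCurves.ModularForms
  Literature.NumberTheory.EllipticCurves.JetchevSkinnerWan2017
  Literature.NumberTheory.EllipticCurves.YanZhu2026
  Summit.BirchSwinnertonDyer.BirchSwinnertonDyer.Theorems.Rank1ResidualX1Defs
  Summit.BirchSwinnertonDyer.Rank1Residual
  Summit.BirchSwinnertonDyer.Rank1Residual.X11b.Three.Koly
  Summit.BirchSwinnertonDyer.Rank1Residual.X11b.KolyvaginBottom
  Summit.BirchSwinnertonDyer.BirchSwinnertonDyer.Rank1Residual
  Summit.BirchSwinnertonDyer.BirchSwinnertonDyer.Theses.PrintX10b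

open Literature.NumberTheory.EllipticCurves.Rank1Residual (ClassX10 Surj)

namespace Summit.BirchSwinnertonDyer.BirchSwinnertonDyer.Cruxes.BeyondCarrierDepthX10b.HowardFrames

/-! ### §1 The parent J₃ `HeegnerDivisibilityX10b` (item 21340) on ALL frames, from the twins -/

/-- **J₃ — `HeegnerDivisibilityX10b` (stmt-BirchSwinnertonDyer-21340) BY NAME, GRANTED the twins A₃
(`hA`, item 23729) and B₃ (`hB`, item 23730) and THREE named facts** (`h331` JSW Thm. 3.3.1, `hChaL`
Cha Rmk. 25 lower half, `hKo` Kolyvagin Thm. A): for every non-CM X10b pair (`p = 3`, `E[3]`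
irreducible, `ρ̄_{E,3}` not onto) with `r_an = 1` there is `B` (`= 4`) such that on every Heegner frame
`K` with `|d_K| > B`, `d_K ≡ 1 (mod 8)`, `N_E` and `3` split, Manin-good `Dt`, `y_K` of infinite order,
for EVERY depth `s ≤ ord_3 ∏ c_q(E)` and every Kolyvagin–Heegner datum of square-free conductor `n` on
Kolyvagin primes of index `≥ s`, the derived point `P_n` is `3^s`-divisible in `E(K[n])` — ANY class
number, NO carrier-depth restriction. Proof = the turnkey T-A argument verbatim
(`stub_beyondCarrier_divisibleClassNumber_of_twins_of_namedFacts`, whose binder `3 ∣ h_K` was idle):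
the index identity over `K` from the twins (`indexIdentityAt_of_heegnerPoint_of_twins_of_thm331`),
`ord_3 [E(K):ℤy_K] = M₀` by McCallum's Lemma 5.1 bookkeeping, and a non-divisible `P_n` at depth
`s ≤ t` is a level-`(s-1)` certificate forcing `2(M₀ - s + 1) ≤ ord_3 #Ш(E/K) = 2M₀ - 2t` (Cha's lower
half) — absurd. Conditional glue; beyond-print theorem: no.
[cite: Cha2005, Thm. 21 and Rmk. 25] [cite: JetchevSkinnerWan2017, Thm. 3.3.1] [cite: Kolyvagin1990, Thm. A]
[cite: McCallumLMS1991, §5 (Lemma 5.1)] [cite: MatarNekovar2019, Prop. 5.26 (2)] [cite: Darmon2004, Thm. 3.7] -/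
theorem heegnerDivisibilityX10b_of_twins_of_namedFacts
    (h331 : thm331_anticyclotomicControl)
    (hChaL : Cha2005.rmk25_pow_dvd_card_sha_primary_of_certificate)
    (hKo : ∀ (N : ℕ) [NeZero N] (W : WeierstrassCurve ℚ) (K : Type) [Field K] [NumberField K],
      kolyvagin N W K)
    (hA : HowardContainmentAnyClassNumberX10b) (hB : TwoSidedLinkAnyClassNumberX10b) :
    HeegnerDivisibilityX10b := by
  intro W _ _ _ p _ hX hns hcm _
  obtain ⟨hp3, hordW, hirr, -⟩ := id hX
  subst hp3
  refine ⟨4, ?_⟩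
  intro K _ _ Dt β ι hK hBK hd8 hHN hHp hβ hc d₁ hd₁ s hs n d hn hℓ
  -- Shimura reciprocity at conductor `1`: a tree THEOREM (Darmon Thm. 3.7)
  have hrec : ∀ (N : ℕ) [NeZero N] (W : WeierstrassCurve ℚ) (K : Type) [Field K] [NumberField K],
      heegnerPointOfConductor_one_galoisConj N W K :=
    fun N _ W K _ _ ↦ heegnerPointOfConductor_one_galoisConj_holds N W K
  have hodd : Odd (NumberField.discr K) := Int.odd_iff.mpr (by omega)
  have hpP : (3 : ℕ).Prime := Fact.out
  have hp2 : (3 : ℕ) ≠ 2 := by norm_num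
  have hneg : NumberField.discr K < 0 := IsImaginaryQuadratic.discr_neg hK
  have hlt : NumberField.discr K < -4 := by omega
  have h3 : NumberField.discr K ≠ -3 := by omega
  have h4 : NumberField.discr K ≠ -4 := by omega
  have hpd : ¬ ((3 : ℕ) : ℤ) ∣ NumberField.discr K :=
    Literature.SatisfiesHeegnerHypothesis.not_dvd_discr hK.1 hHp hpP (dvd_refl 3)
  have hpN : ¬ 3 ∣ W.conductorNorm ℤ := fun h ↦
    (W.dvd_conductorNorm_iff_not_hasGoodReductionAtPrime 3).mp h hordW.1
  have hpN2 : ¬ 3 ^ 2 ∣ W.conductorNorm ℤ := fun h ↦ hpN (dvd_trans (dvd_pow_self 3 two_ne_zero) h)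
  -- depth `0` is trivial
  rcases Nat.eq_zero_or_pos s with rfl | hs1
  · exact ⟨d.derivedPoint, by rw [pow_zero, Nat.cast_one, one_zsmul]⟩
  -- the oriented Heegner datum of the frame and THE Heegner point `y_K ∈ E(K)`
  obtain ⟨H, hHβ⟩ := exists_heegnerDatum (W.conductorNorm ℤ) hneg hβ
  obtain ⟨P, hP⟩ := heegnerPointComplex_mem_range_map_holds (W.conductorNorm ℤ) W K hK hHN Dt H ι
  have hPd : d₁.toGeomPoints d₁.derivedPoint = toGeomPoints (W.baseChange K) P :=
    toGeomPoints_derivedPoint_one_eq (hrec _ W K) hK hHN hP d₁ hHβ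
  have hPinf : ¬ IsOfFinAddOrder P := fun hfin ↦
    hd₁ ((isOfFinAddOrder_derivedPoint_one_iff (hrec _ W K) hK hHN hP d₁ hHβ).mpr hfin)
  -- the identity over `K` at this frame, ANY class number (from the twins)
  have hid := indexIdentityAt_of_heegnerPoint_of_twins_of_thm331 hA hB h331 W 3 hX hns hcm K
    (hKo _ W K) hK hodd hlt hHN hHp Dt H ι P hP hPinf hc
  -- rank one and finiteness over `K` (Kolyvagin), no `3`-torsion (irreducibility)
  obtain ⟨hrank, hshaK⟩ := hKo (W.conductorNorm ℤ) W K hK hHN ⟨Dt, H, ι, hP⟩ hPinf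
  haveI : Finite (W.baseChange K).sha := hshaK
  haveI hfinp : Finite (AddCommGroup.primaryComponent (W.baseChange K).sha 3) :=
    Finite.of_injective _ Subtype.val_injective
  have hbot := torsionBy_eq_bot_of_isImaginaryQuadratic_of_hasIrreducibleModPGaloisRep W K hK hpP hirr
  have hiv : ∀ x : (W.baseChange K).toAffine.Point, 3 • x = 0 → x = 0 := fun x hx ↦ by
    have hmem : x ∈ AddSubgroup.torsionBy (W.baseChange K).toAffine.Point (((3 : ℕ) : ℕ) : ℤ) := by
      rw [mem_torsionBy_iff, natCast_zsmul]
      exact hx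
    rw [hbot] at hmem
    exact hmem
  -- the exponent `3^{M₀} ∥ y_K` in `E(K)` and `ord_3 [E(K):ℤy_K] = M₀` (McCallum Lemma 5.1)
  haveI : Module.Finite ℤ (W.baseChange K).toAffine.Point := (W.baseChange K).module_finite_point_holds
  obtain ⟨M₀, x₀, hx₀, hmax⟩ := exists_pow_smul_eq_and_forall_ne hPinf (p := 3) hpP.two_le
  have hdiv : ∃ Q : (W.baseChange K).toAffine.Point, ((3 ^ M₀ : ℕ) : ℤ) • Q = P :=
    ⟨x₀, by rw [natCast_zsmul]; exact hx₀⟩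
  have hndiv : ¬ ∃ Q : (W.baseChange K).toAffine.Point, ((3 ^ (M₀ + 1) : ℕ) : ℤ) • Q = P := by
    rintro ⟨Q, hQ⟩
    exact hmax Q (by rw [← natCast_zsmul]; exact hQ)
  haveI : Finite (AddCommGroup.torsion (W.baseChange K).toAffine.Point) :=
    WeierstrassCurve.finite_torsion_point (W := W.baseChange K)
  obtain ⟨c, Q, hcQ, hcker⟩ := X11b.RankOne.exists_coord_of_mordellWeilRank_eq_one (W.baseChange K) hrank
  have hidx : padicValNat 3 (AddSubgroup.zmultiples P).index = M₀ :=
    padicValNat_index_zmultiples_eq_of_divisibility c Q hcQ hcker hiv P hdiv hndiv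
  -- suppose `P_n ∉ 3^s E(K_n)`: a level-`(s-1)` certificate; Cha's LOWER half bounds `#Ш` from below
  by_contra hQ
  have hcert := hChaL W hcm K hK h3 h4 hHN 3 hp2 hpd hpN2 hirr Dt β ι d₁ P hPd hPinf M₀
    hdiv hndiv n (s - 1) d hn
    (fun ℓ hℓ' ↦ ⟨(hℓ ℓ hℓ').1, by have := (hℓ ℓ hℓ').2; omega⟩)
    (by rw [Nat.sub_add_cancel hs1]; exact hQ)
  have hle : 2 * (M₀ - (s - 1)) ≤
      padicValNat 3 (Nat.card (AddCommGroup.primaryComponent (W.baseChange K).sha 3)) :=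
    (padicValNat_dvd_iff_le Nat.card_pos.ne').mp hcert
  rw [padicValNat_card_addPrimaryComponent (A := (W.baseChange K).sha) 3] at hle
  -- the identity: `2t + ord_3 #Ш(E/K) = 2M₀`
  unfold X11b.IndexIdentityAt at hid
  rw [WeierstrassCurve.shaOrder, hidx] at hid
  omega

/-! ### §2 The child crux `BeyondCarrierDepthX10b` (item 23055): registered stub of skeleton v4 and the door -/

/-- **`BeyondCarrierDepthX10b` is a weakening of its parent `HeegnerDivisibilityX10b`** (one inserted
hypothesis, the beyond-carrier clause `∀ q ∣ N_E, ord_3 c_q(E) < s`, is dropped): the converse direction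
of the route's split glue `HeegnerDivisibilityX10bGlueBy_holds` needs no print fact at all.
[cite: Cha2005, Rmk. 25 (the depth bookkeeping `s ≤ ord_p ∏ c_q`)] -/
theorem beyondCarrierDepthX10b_of_heegnerDivisibilityX10b (hJ : HeegnerDivisibilityX10b) :
    BeyondCarrierDepthX10b := by
  intro W _ _ _ p _ hX hns hcm hr
  obtain ⟨B, hJB⟩ := hJ W p hX hns hcm hr
  refine ⟨B, ?_⟩
  intro K _ _ Dt β ι hK hBK hd8 hHN hHp hβ hc d₁ hd₁ s _ hs n d hn hℓ
  exact hJB K Dt β ι hK hBK hd8 hHN hHp hβ hc d₁ hd₁ s hs n d hn hℓ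

/-- **Stub `stub_beyondCarrier_allFrames_of_twins` of crux `BeyondCarrierDepthX10b` (item 23055, line
«twins», skeleton v4 of the lead seat bsd-line-x10b-p1), registered signature VERBATIM, modulo THREE
named facts** (`h331` JSW Thm. 3.3.1, `hChaL` Cha Rmk. 25 lower half, `hKo` Kolyvagin Thm. A): the twins
A₃ (item 23729) and B₃ (item 23730) give the body of the crux on ALL rev-3b X10b frames — no class-number
split, hence no Mastella–Zerman Cor. 4.6 and no Yan–Zhu composite in this stub's trust base.
[cite: Cha2005, Thm. 21 and Rmk. 25] [cite: JetchevSkinnerWan2017, Thm. 3.3.1] [cite: Kolyvagin1990, Thm. A] -/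
theorem stub_beyondCarrier_allFrames_of_twins_of_namedFacts
    (h331 : thm331_anticyclotomicControl)
    (hChaL : Cha2005.rmk25_pow_dvd_card_sha_primary_of_certificate)
    (hKo : ∀ (N : ℕ) [NeZero N] (W : WeierstrassCurve ℚ) (K : Type) [Field K] [NumberField K],
      kolyvagin N W K) :
    HowardContainmentAnyClassNumberX10b → TwoSidedLinkAnyClassNumberX10b →
    ∀ (W : WeierstrassCurve ℚ) [W.IsElliptic] [W.IsGloballyMinimal] [NeZero (W.conductorNorm ℤ)] (p : ℕ) [Fact p.Prime], Literature.NumberTheory.EllipticCurves.Rank1Residual.ClassX10 W p → ¬ Literature.NumberTheory.EllipticCurves.Rank1Residual.Surj W 3 → ¬ W.HasCM → W.analyticRank = 1 → ∃ B : ℕ, ∀ (K : Type) [Field K] [NumberField K] (Dt : Literature.NumberTheory.EllipticCurves.ModularForms.ModularParametrizationData W (W.conductorNorm ℤ)) (β : ℤ) (ι : K →+* ℂ), Literature.NumberTheory.EllipticCurves.IsImaginaryQuadratic K → B < (NumberField.discr K).natAbs → NumberField.discr K % 8 = 1 → Literature.NumberTheory.EllipticCurves.SatisfiesHeegnerHypothesis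 (W.conductorNorm ℤ) K → Literature.NumberTheory.EllipticCurves.SatisfiesHeegnerHypothesis p K → (4 * (W.conductorNorm ℤ : ℤ)) ∣ β ^ 2 - NumberField.discr K → ¬ (p : ℤ) ∣ Dt.c → ∀ (d₁ : Literature.NumberTheory.EllipticCurves.KolyvaginHeegnerData Dt β ι 1), ¬ IsOfFinAddOrder d₁.derivedPoint → ∀ (s : ℕ), (∀ (q : ℕ) [Fact q.Prime], q ∣ W.conductorNorm ℤ → padicValNat p ((W.baseChange ℚ_[q]).localTamagawaNumber ℤ_[q]) < s) → s ≤ padicValNat p W.tamagawaProduct → ∀ (n : ℕ) (d : Literature.NumberTheory.EllipticCurves.KolyvaginHeegnerData Dt β ι n), Squarefree n → (∀ ℓ ∈ n.primeFactors, Literature.NumberTheory.EllipticCurves.Zhang2014.IsKolyvaginPrime (W.conductorNorm ℤ) W K p ℓ ∧ s ≤ Literature.NumberTheory.EllipticCurves.Zhang2014.kolyvaginIndex W p ℓ) → ∃ Q : (W.baseChange (Literature.NumberTheory.EllipticCurves.ringClassField K ι n)).toAffine.Point, ((p ^ s : ℕ) : ℤ) • Q = d.derivedPoint :=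
  fun hA hB ↦ beyondCarrierDepthX10b_of_heegnerDivisibilityX10b
    (heegnerDivisibilityX10b_of_twins_of_namedFacts h331 hChaL hKo hA hB)

/-- **Crux `BeyondCarrierDepthX10b` (item 23055) BY NAME, GRANTED three named facts and the two crux
ITEMS BY NAME** — `h331` (JSW Thm. 3.3.1), `hChaL` (Cha Rmk. 25, lower half), `hKo` (Kolyvagin Thm. A),
`hA : HowardContainmentAnyClassNumberX10b` (item 23729), `hB : TwoSidedLinkAnyClassNumberX10b` (item
23730): the door `beyondCarrierDepthX10b_of_namedFacts_of_twins` (module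
`Rank1Residual.X10.BeyondCarrierDoorOfTwins`) with its two idle premisses `h46` (Mastella–Zerman Cor. 4.6)
and `hYZ` (Yan–Zhu/BCS/CGLS composite) removed. The crux is thereby REDUCED in the kernel to
23729 ∧ 23730 modulo {JSW 3.3.1, Kolyvagin Thm. A, Cha Rmk. 25 lower}; it is not closed.
[cite: Cha2005, Thm. 21 and Rmk. 25] [cite: JetchevSkinnerWan2017, Thm. 3.3.1] [cite: Kolyvagin1990, Thm. A] -/
theorem beyondCarrierDepthX10b_of_twins_of_threeFacts
    (h331 : thm331_anticyclotomicControl)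
    (hChaL : Cha2005.rmk25_pow_dvd_card_sha_primary_of_certificate)
    (hKo : ∀ (N : ℕ) [NeZero N] (W : WeierstrassCurve ℚ) (K : Type) [Field K] [NumberField K],
      kolyvagin N W K)
    (hA : HowardContainmentAnyClassNumberX10b) (hB : TwoSidedLinkAnyClassNumberX10b) :
    BeyondCarrierDepthX10b :=
  beyondCarrierDepthX10b_of_heegnerDivisibilityX10b
    (heegnerDivisibilityX10b_of_twins_of_namedFacts h331 hChaL hKo hA hB)

end Summit.BirchSwinnertonDyer.BirchSwinnertonDyer.Cruxes.BeyondCarrierDepthX10b.HowardFrames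

end
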